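import Summits.QuantumFields.GaugeBoot.PeriodicWords
import Summits.QuantumFields.GaugeBoot.TiltedLatticeSymmetry
import HarnessLib

/-!
# Word holonomies under translations of a periodic lattice: base-point independence of loop expectations (gauge-boot, periodic loop equations, supplement)

HONEST FRAMING (cell `pub-gaugeboot`, page 1 of every file): the venture produces certified bounds
on lattice expectations at stated coupling, gauge group, dimension and torus size; NOT a mass gap,
NOT a continuum limit, NOT a string tension; NOT Yang–Mills-summit-bearing (barriers
`FixedCouplingUltralocality`, `PerturbativeInvisibility`).

The SYMMETRY input of the lattice bootstrap for the word variables of the periodic loop equation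
(`PeriodicLoopEquation.lean`): on a periodic lattice `(A, e)` the Wilson measure `μ_β = gibbs ρ e β` is
invariant under the translations `τ_a` of `TiltedLatticeSymmetry.lean`, and a word holonomy read from
`x` in the translated configuration is the same word read from `x + a`
(`wordHolonomy_translate`). Hence the expectations that enter the rows — `E[tr ρ(hol_x w)]` and the
pair variables `E[tr ρ(hol_x u) · tr ρ(hol_x v)]` — do NOT depend on the base point `x`
(`integral_trace_wordHolonomy_add`, `integral_trace_mul_trace_wordHolonomy_add`; compact second
countable `G`, continuous `ρ`, every real `β`). This is the periodic-lattice form of the identification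
"a loop variable is a word up to translation" used by every loop-equation generator (Kazakov–Zheng
arXiv:2203.11360 §3.3); on the 45°-tilted box it is the statement that rows are indexed by words modulo
`Γ`-translations. Everything is `[folklore]`.

References: V. Kazakov, Z. Zheng, arXiv:2203.11360 §3.3 (reduction by the symmetry group); S. Cao, M. Park, S. Sheffield,
Comm. AMS 5 (2025), Thm. 5.7 (`U(N)`) / Thm. 6.104 (`SU(N)`) (arXiv:2307.06790 numbering; informally Thm. 1.14).
-/

noncomputable section

open MeasureTheory

namespace Summit.QuantumFields.GaugeBoot

namespace TiltedRP

variable {A : Type*} [AddCommGroup A] {d N : ℕ} {G : Type*} [Group G]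

/-! ### Words in the translated configuration -/

/-- A step holonomy of the translated configuration is the step holonomy from the translated base
point. [folklore] -/
theorem stepHolonomy_translate (e : Fin d → A) (a : A) (U : Config A d G) (x : A) (s : Step d) :
    stepHolonomy e (translate a U) x s = stepHolonomy e U (x + a) s := by
  cases s with
  | fwd μ => rfl
  | bwd μ => simp only [stepHolonomy_bwd, translate_apply, sub_add_eq_add_sub]

/-- A step moves translated base points to translated endpoints. [folklore] -/
theorem move_add (e : Fin d → A) (a : A) (x : A) (s : Step d) : s.move e (x + a) = s.move e x + a := by
  cases s with
  | fwd μ => simp only [Step.move_fwd, add_right_comm]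
  | bwd μ => simp only [Step.move_bwd, sub_add_eq_add_sub]

/-- **A word holonomy of the translated configuration is the word holonomy from the translated base
point**: `hol_x(w)(τ_a U) = hol_{x+a}(w)(U)`. [folklore] -/
theorem wordHolonomy_translate (e : Fin d → A) (a : A) (U : Config A d G) :
    ∀ (x : A) (w : Word d), wordHolonomy e (translate a U) x w = wordHolonomy e U (x + a) w
  | x, [] => rfl
  | x, s :: w => by
    rw [wordHolonomy_cons, wordHolonomy_cons, stepHolonomy_translate, wordHolonomy_translate e a U,
      move_add]

/-- Endpoints translate. [folklore] -/
theorem Word.endpoint_add (e : Fin d → A) (a : A) :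
    ∀ (x : A) (w : Word d), Word.endpoint e (x + a) w = Word.endpoint e x w + a
  | x, [] => rfl
  | x, s :: w => by rw [Word.endpoint_cons, Word.endpoint_cons, move_add, Word.endpoint_add e a]

/-- A word closed at `x` is closed at every translate of `x`. [folklore] -/
theorem Word.endpoint_add_eq_iff (e : Fin d → A) (a x : A) (w : Word d) :
    Word.endpoint e (x + a) w = x + a ↔ Word.endpoint e x w = x := by
  rw [Word.endpoint_add, add_left_inj]

/-! ### Base-point independence of loop expectations -/

section Expectation

variable [Fintype A] [TopologicalSpace G] [IsTopologicalGroup G] [CompactSpace G] [MeasurableSpace G]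
  [BorelSpace G] [SecondCountableTopology G] (ρ : G →* Matrix (Fin N) (Fin N) ℂ)

omit [CompactSpace G] in
/-- The trace of a word holonomy is a measurable function of the configuration (continuous `ρ`).
[folklore] -/
theorem measurable_trace_wordHolonomy (hρ : Continuous ρ) (e : Fin d → A) (x : A) (w : Word d) :
    Measurable fun U : Config A d G => (ρ (wordHolonomy e U x w)).trace :=
  (hρ.comp (continuous_wordHolonomy e x w)).matrix_trace.measurable

/-- **Loop expectations do not depend on the base point**: `E[tr ρ(hol_{x+a} w)] = E[tr ρ(hol_x w)]`
for every word `w`, every `a`, every real `β` (translation invariance of the Wilson measure of the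
periodic lattice). [folklore] -/
theorem integral_trace_wordHolonomy_add (hρ : Continuous ρ) (e : Fin d → A) (β : ℝ) (a x : A)
    (w : Word d) :
    ∫ U, (ρ (wordHolonomy e U (x + a) w)).trace ∂(gibbs ρ e β) =
      ∫ U, (ρ (wordHolonomy e U x w)).trace ∂(gibbs ρ e β) := by
  have h := integral_comp_translate_gibbs_complex ρ hρ e β a
    (F := fun U => (ρ (wordHolonomy e U x w)).trace) (measurable_trace_wordHolonomy ρ hρ e x w)
  simp only [wordHolonomy_translate] at h
  exact h

/-- **Pair variables do not depend on the base point**: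
`E[tr ρ(hol_{x+a} u) · tr ρ(hol_{x+a} v)] = E[tr ρ(hol_x u) · tr ρ(hol_x v)]`. [folklore] -/
theorem integral_trace_mul_trace_wordHolonomy_add (hρ : Continuous ρ) (e : Fin d → A) (β : ℝ)
    (a x : A) (u v : Word d) :
    ∫ U, (ρ (wordHolonomy e U (x + a) u)).trace * (ρ (wordHolonomy e U (x + a) v)).trace ∂(gibbs ρ e β) =
      ∫ U, (ρ (wordHolonomy e U x u)).trace * (ρ (wordHolonomy e U x v)).trace ∂(gibbs ρ e β) := by
  have h := integral_comp_translate_gibbs_complex ρ hρ e β a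
    (F := fun U => (ρ (wordHolonomy e U x u)).trace * (ρ (wordHolonomy e U x v)).trace)
    ((measurable_trace_wordHolonomy ρ hρ e x u).mul (measurable_trace_wordHolonomy ρ hρ e x v))
  simp only [wordHolonomy_translate] at h
  exact h

/-- Real loop variables: `E[Re tr ρ(hol_{x+a} w)] = E[Re tr ρ(hol_x w)]`. [folklore] -/
theorem integral_re_trace_wordHolonomy_add (hρ : Continuous ρ) (e : Fin d → A) (β : ℝ) (a x : A)
    (w : Word d) :
    ∫ U, (ρ (wordHolonomy e U (x + a) w)).trace.re ∂(gibbs ρ e β) =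
      ∫ U, (ρ (wordHolonomy e U x w)).trace.re ∂(gibbs ρ e β) := by
  have h := integral_comp_translate_gibbs ρ hρ e β a
    (F := fun U => (ρ (wordHolonomy e U x w)).trace.re)
    (Complex.measurable_re.comp (measurable_trace_wordHolonomy ρ hρ e x w))
  simp only [wordHolonomy_translate] at h
  exact h

end Expectation

end TiltedRP

end Summit.QuantumFields.GaugeBoot

end
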